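import Mathlib.Topology.UnitInterval
import Mathlib.Topology.Order.ProjIcc
import Mathlib.Analysis.Complex.Basic
import Mathlib.Order.ConditionallyCompleteLattice.Basic

/-!
# Trimming the polyline at its last visit of `a` and first visit of `b`
# (route `SAWReversalUpgrade`, helper for item `AttachmentExists`, stmt-CriticalPhenomena-18009)

Abstract bookkeeping for the standard boundary attachment. `P : C([0,1], ℂ)` is a curve in
`closure D` from `P 0 ∈ D` to `P 1 ∈ D` (the polyline of a SAW), injective up to a constant tail
`[τ, 1]` on which it rests at `P 1`; `R = P ∘ projIcc` is its extension to `ℝ`; `a, b ∉ D` are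
the marked boundary points. The route statement trims `R` at
`i = sSup ({0} ∪ {u ∈ [0,1] | R u = a})` (last visit of `a`, or `0`) and
`j = sInf ({1} ∪ {u ∈ [0,1] | R u = b})` (first visit of `b`, or `1`). We record the elementary
properties of `R`, `i`, `j` consumed by the construction (`trim_*`).

Folklore real analysis (`sSup`/`sInf` of closed bounded sets).
-/

noncomputable section

namespace Summit.CriticalPhenomena.SAWScalingLimit.Theorems

open Set Function Filter Topology
open scoped unitInterval

variable {D : Set ℂ} {a b : ℂ} {P : C(I, ℂ)} {R : ℝ → ℂ} {τ i j : ℝ}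

/-! ### The extended curve `R = P ∘ projIcc` -/

/-- `R` is continuous. [folklore] -/
theorem trim_R_continuous (hR : ∀ u, R u = P (projIcc 0 1 zero_le_one u)) : Continuous R := by
  rw [show R = fun u => P (projIcc 0 1 zero_le_one u) from funext hR]
  exact P.continuous.comp continuous_projIcc

/-- `R 0 = P 0` and `R 1 = P 1`. [folklore] -/
theorem trim_R_zero_one (hR : ∀ u, R u = P (projIcc 0 1 zero_le_one u)) :
    R 0 = P 0 ∧ R 1 = P 1 := by
  constructor
  · rw [hR, projIcc_left]; rfl
  · rw [hR, projIcc_right]; rfl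

/-- `R` takes the values of `P`. [folklore] -/
theorem trim_R_mem (hR : ∀ u, R u = P (projIcc 0 1 zero_le_one u)) {S : Set ℂ}
    (hP : ∀ t, P t ∈ S) (u : ℝ) : R u ∈ S := by
  rw [hR]; exact hP _

/-- On `[0, 1]`, `R u = P u`. [folklore] -/
theorem trim_R_of_mem (hR : ∀ u, R u = P (projIcc 0 1 zero_le_one u)) {u : ℝ}
    (hu : u ∈ Icc (0 : ℝ) 1) : R u = P ⟨u, hu⟩ := by
  rw [hR, projIcc_of_mem _ hu]

/-- **The constant tail**: `R u = P 1` for `u ≥ τ`. [folklore] -/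
theorem trim_R_tail (hR : ∀ u, R u = P (projIcc 0 1 zero_le_one u)) (hτ0 : 0 ≤ τ)
    (hPtail : ∀ t : I, τ ≤ (t : ℝ) → P t = P 1) {u : ℝ} (hu : τ ≤ u) : R u = P 1 := by
  rcases le_or_gt u 1 with hu1 | hu1
  · rw [trim_R_of_mem hR ⟨hτ0.trans hu, hu1⟩]
    exact hPtail _ hu
  · rw [hR, projIcc_of_right_le _ hu1.le]; rfl

/-- **Injectivity up to the tail**: equal values of `R` at `s < t` in `[0, 1]` force `τ ≤ s`.
[folklore] -/
theorem trim_R_inj (hR : ∀ u, R u = P (projIcc 0 1 zero_le_one u))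
    (hPinj : ∀ s t : I, s < t → P s = P t → τ ≤ (s : ℝ)) {s t : ℝ} (hs : s ∈ Icc (0 : ℝ) 1)
    (ht : t ∈ Icc (0 : ℝ) 1) (hst : s < t) (heq : R s = R t) : τ ≤ s := by
  rw [trim_R_of_mem hR hs, trim_R_of_mem hR ht] at heq
  exact hPinj ⟨s, hs⟩ ⟨t, ht⟩ hst heq

/-- Points of the tail are not `b` (`P 1 ∈ D ∌ b`). [folklore] -/
theorem trim_R_ne_of_tail (hR : ∀ u, R u = P (projIcc 0 1 zero_le_one u)) (hτ0 : 0 ≤ τ)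
    (hPtail : ∀ t : I, τ ≤ (t : ℝ) → P t = P 1) (hbD : b ∉ D) (hP1 : P 1 ∈ D) {u : ℝ}
    (hu : τ ≤ u) : R u ≠ b := by
  rw [trim_R_tail hR hτ0 hPtail hu]
  exact fun h => hbD (h ▸ hP1)

/-! ### The last visit `i` of `a` -/

/-- `i ∈ [0, 1]`, and either `R i = a`, or `i = 0` and `R` never visits `a` on `[0, 1]`.
[folklore] -/
theorem trim_i_spec (hR : ∀ u, R u = P (projIcc 0 1 zero_le_one u))
    (hi : i = sSup ({(0 : ℝ)} ∪ {u | u ∈ Icc (0 : ℝ) 1 ∧ R u = a})) :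
    i ∈ Icc (0 : ℝ) 1 ∧ (R i = a ∨ (i = 0 ∧ ∀ u ∈ Icc (0 : ℝ) 1, R u ≠ a)) := by
  set S : Set ℝ := {(0 : ℝ)} ∪ {u | u ∈ Icc (0 : ℝ) 1 ∧ R u = a} with hS
  have hne : S.Nonempty := ⟨0, Or.inl rfl⟩
  have hbdd : BddAbove S := ⟨1, by rintro u (rfl | ⟨hu, -⟩); exacts [zero_le_one, hu.2]⟩
  have hclosed : IsClosed S := by
    refine (isClosed_singleton).union ?_
    exact (isClosed_Icc.inter (isClosed_singleton.preimage (trim_R_continuous hR)))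
  have hmem : i ∈ S := hi ▸ hclosed.csSup_mem hne hbdd
  have hi0 : 0 ≤ i := hi ▸ le_csSup hbdd (Or.inl rfl)
  have hi1 : i ≤ 1 := hi ▸ csSup_le hne (by rintro u (rfl | ⟨hu, -⟩); exacts [zero_le_one, hu.2])
  refine ⟨⟨hi0, hi1⟩, ?_⟩
  rcases hmem with h0 | ⟨-, hRa⟩
  · by_cases hex : ∃ u ∈ Icc (0 : ℝ) 1, R u = a
    · obtain ⟨u, hu, hua⟩ := hex
      have hle : u ≤ i := hi ▸ le_csSup hbdd (Or.inr ⟨hu, hua⟩)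
      have hu0 : u = 0 := le_antisymm (h0 ▸ hle) hu.1
      left; rw [h0, ← hu0]; exact hua
    · right
      exact ⟨h0, fun u hu hua => hex ⟨u, hu, hua⟩⟩
  · exact Or.inl hRa

/-- **No visit of `a` after `i`.** [folklore] -/
theorem trim_R_ne_a_of_gt (hi : i = sSup ({(0 : ℝ)} ∪ {u | u ∈ Icc (0 : ℝ) 1 ∧ R u = a}))
    {u : ℝ} (hiu : i < u) (hu : u ∈ Icc (0 : ℝ) 1) : R u ≠ a := by
  intro hua
  have hbdd : BddAbove ({(0 : ℝ)} ∪ {u | u ∈ Icc (0 : ℝ) 1 ∧ R u = a}) :=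
    ⟨1, by rintro u (rfl | ⟨hu, -⟩); exacts [zero_le_one, hu.2]⟩
  have hle : u ≤ i := hi ▸ le_csSup hbdd (Or.inr ⟨hu, hua⟩)
  linarith

/-- `R i` is `a` or the starting point `P 0`. [folklore] -/
theorem trim_R_i (hR : ∀ u, R u = P (projIcc 0 1 zero_le_one u))
    (hi : i = sSup ({(0 : ℝ)} ∪ {u | u ∈ Icc (0 : ℝ) 1 ∧ R u = a})) :
    R i = a ∨ (i = 0 ∧ R i = P 0) := by
  rcases (trim_i_spec hR hi).2 with h | ⟨h0, -⟩
  · exact Or.inl h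
  · exact Or.inr ⟨h0, by rw [h0, (trim_R_zero_one hR).1]⟩

/-- `R i ∈ closure D ∖ {b}`. [folklore] -/
theorem trim_R_i_mem (hR : ∀ u, R u = P (projIcc 0 1 zero_le_one u))
    (hi : i = sSup ({(0 : ℝ)} ∪ {u | u ∈ Icc (0 : ℝ) 1 ∧ R u = a})) (hab : a ≠ b)
    (hbD : b ∉ D) (hPcl : ∀ t, P t ∈ closure D) (hP0 : P 0 ∈ D) :
    R i ∈ closure D \ {b} := by
  refine ⟨trim_R_mem hR hPcl i, fun h => ?_⟩
  rw [mem_singleton_iff] at h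
  rcases trim_R_i hR hi with h' | ⟨-, h'⟩
  · exact hab (h'.symm.trans h)
  · exact hbD (h ▸ h' ▸ hP0)

/-- `i ≤ τ` (after `τ` the curve rests at `P 1 ∈ D`, which is not `a`; and `τ ≥ 0`). [folklore] -/
theorem trim_i_le_tau (hR : ∀ u, R u = P (projIcc 0 1 zero_le_one u))
    (hi : i = sSup ({(0 : ℝ)} ∪ {u | u ∈ Icc (0 : ℝ) 1 ∧ R u = a})) (hτ0 : 0 ≤ τ)
    (hPtail : ∀ t : I, τ ≤ (t : ℝ) → P t = P 1) (haD : a ∉ D) (hP1 : P 1 ∈ D) : i ≤ τ := by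
  by_contra h
  rw [not_le] at h
  rcases (trim_i_spec hR hi).2 with hRa | ⟨h0, -⟩
  · rw [trim_R_tail hR hτ0 hPtail h.le] at hRa
    exact haD (hRa ▸ hP1)
  · rw [h0] at h
    exact absurd h (not_lt.2 hτ0)

/-! ### The first visit `j` of `b` -/

/-- `j ∈ [0, 1]`, and either `R j = b`, or `j = 1` and `R` never visits `b` on `[0, 1]`.
[folklore] -/
theorem trim_j_spec (hR : ∀ u, R u = P (projIcc 0 1 zero_le_one u))
    (hj : j = sInf ({(1 : ℝ)} ∪ {u | u ∈ Icc (0 : ℝ) 1 ∧ R u = b})) :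
    j ∈ Icc (0 : ℝ) 1 ∧ (R j = b ∨ (j = 1 ∧ ∀ u ∈ Icc (0 : ℝ) 1, R u ≠ b)) := by
  set S : Set ℝ := {(1 : ℝ)} ∪ {u | u ∈ Icc (0 : ℝ) 1 ∧ R u = b} with hS
  have hne : S.Nonempty := ⟨1, Or.inl rfl⟩
  have hbdd : BddBelow S := ⟨0, by rintro u (rfl | ⟨hu, -⟩); exacts [zero_le_one, hu.1]⟩
  have hclosed : IsClosed S := by
    refine (isClosed_singleton).union ?_
    exact (isClosed_Icc.inter (isClosed_singleton.preimage (trim_R_continuous hR)))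
  have hmem : j ∈ S := hj ▸ hclosed.csInf_mem hne hbdd
  have hj1 : j ≤ 1 := hj ▸ csInf_le hbdd (Or.inl rfl)
  have hj0 : 0 ≤ j := hj ▸ le_csInf hne (by rintro u (rfl | ⟨hu, -⟩); exacts [zero_le_one, hu.1])
  refine ⟨⟨hj0, hj1⟩, ?_⟩
  rcases hmem with h1 | ⟨-, hRb⟩
  · by_cases hex : ∃ u ∈ Icc (0 : ℝ) 1, R u = b
    · obtain ⟨u, hu, hub⟩ := hex
      have hle : j ≤ u := hj ▸ csInf_le hbdd (Or.inr ⟨hu, hub⟩)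
      have hu1 : u = 1 := le_antisymm hu.2 (h1 ▸ hle)
      left; rw [h1, ← hu1]; exact hub
    · right
      exact ⟨h1, fun u hu hub => hex ⟨u, hu, hub⟩⟩
  · exact Or.inl hRb

/-- **No visit of `b` before `j`.** [folklore] -/
theorem trim_R_ne_b_of_lt (hj : j = sInf ({(1 : ℝ)} ∪ {u | u ∈ Icc (0 : ℝ) 1 ∧ R u = b}))
    {u : ℝ} (huj : u < j) (hu : u ∈ Icc (0 : ℝ) 1) : R u ≠ b := by
  intro hub
  have hbdd : BddBelow ({(1 : ℝ)} ∪ {u | u ∈ Icc (0 : ℝ) 1 ∧ R u = b}) :=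
    ⟨0, by rintro u (rfl | ⟨hu, -⟩); exacts [zero_le_one, hu.1]⟩
  have hle : j ≤ u := hj ▸ csInf_le hbdd (Or.inr ⟨hu, hub⟩)
  linarith

/-- `R j` is `b` or the final point `P 1` (then `j = 1`). [folklore] -/
theorem trim_R_j (hR : ∀ u, R u = P (projIcc 0 1 zero_le_one u))
    (hj : j = sInf ({(1 : ℝ)} ∪ {u | u ∈ Icc (0 : ℝ) 1 ∧ R u = b})) :
    R j = b ∨ (j = 1 ∧ R j = P 1) := by
  rcases (trim_j_spec hR hj).2 with h | ⟨h1, -⟩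
  · exact Or.inl h
  · exact Or.inr ⟨h1, by rw [h1, (trim_R_zero_one hR).2]⟩

/-- If the curve visits `b`, it does so before the tail: `R j = b → j < τ`. [folklore] -/
theorem trim_j_lt_tau (hR : ∀ u, R u = P (projIcc 0 1 zero_le_one u)) (hτ0 : 0 ≤ τ)
    (hPtail : ∀ t : I, τ ≤ (t : ℝ) → P t = P 1) (hbD : b ∉ D) (hP1 : P 1 ∈ D)
    (hRj : R j = b) : j < τ := by
  by_contra h
  exact trim_R_ne_of_tail hR hτ0 hPtail hbD hP1 (not_lt.1 h) hRj

/-- `j` is positive (`R 0 = P 0 ∈ D` is not `b`). [folklore] -/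
theorem trim_j_pos (hR : ∀ u, R u = P (projIcc 0 1 zero_le_one u))
    (hj : j = sInf ({(1 : ℝ)} ∪ {u | u ∈ Icc (0 : ℝ) 1 ∧ R u = b})) (hbD : b ∉ D)
    (hP0 : P 0 ∈ D) : 0 < j := by
  obtain ⟨⟨hj0, -⟩, h⟩ := trim_j_spec hR hj
  rcases hj0.eq_or_lt with h0 | h0
  · exfalso
    rcases h with hRb | ⟨h1, -⟩
    · rw [← h0, (trim_R_zero_one hR).1] at hRb
      exact hbD (hRb ▸ hP0)
    · linarith
  · exact h0

/-- On `[i, j]` (indeed on `[0, j]` off `j`), points other than `j` are not sent to `b`; at `j`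
the value is `b` or `P 1`. Summary form: for `u ∈ [i, j]`, `R u = b → u = j`. [folklore] -/
theorem trim_eq_j_of_R_eq_b (hR : ∀ u, R u = P (projIcc 0 1 zero_le_one u))
    (hi : i = sSup ({(0 : ℝ)} ∪ {u | u ∈ Icc (0 : ℝ) 1 ∧ R u = a}))
    (hj : j = sInf ({(1 : ℝ)} ∪ {u | u ∈ Icc (0 : ℝ) 1 ∧ R u = b})) {u : ℝ}
    (hu : u ∈ Icc i j) (hub : R u = b) : u = j := by
  have hu01 : u ∈ Icc (0 : ℝ) 1 :=
    ⟨(trim_i_spec hR hi).1.1.trans hu.1, hu.2.trans (trim_j_spec hR hj).1.2⟩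
  rcases hu.2.lt_or_eq with hlt | heq
  · exact absurd hub (trim_R_ne_b_of_lt hj hlt hu01)
  · exact heq

/-- For `u ∈ [i, j]`, `R u = a → u = i`. [folklore] -/
theorem trim_eq_i_of_R_eq_a (hR : ∀ u, R u = P (projIcc 0 1 zero_le_one u))
    (hi : i = sSup ({(0 : ℝ)} ∪ {u | u ∈ Icc (0 : ℝ) 1 ∧ R u = a}))
    (hj : j = sInf ({(1 : ℝ)} ∪ {u | u ∈ Icc (0 : ℝ) 1 ∧ R u = b})) {u : ℝ}
    (hu : u ∈ Icc i j) (hua : R u = a) : u = i := by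
  have hu01 : u ∈ Icc (0 : ℝ) 1 :=
    ⟨(trim_i_spec hR hi).1.1.trans hu.1, hu.2.trans (trim_j_spec hR hj).1.2⟩
  rcases hu.1.lt_or_eq with hlt | heq
  · exact absurd hua (trim_R_ne_a_of_gt hi hlt hu01)
  · exact heq.symm

/-- `[i, j] ⊆ [0, 1]`. [folklore] -/
theorem trim_Icc_subset (hR : ∀ u, R u = P (projIcc 0 1 zero_le_one u))
    (hi : i = sSup ({(0 : ℝ)} ∪ {u | u ∈ Icc (0 : ℝ) 1 ∧ R u = a}))
    (hj : j = sInf ({(1 : ℝ)} ∪ {u | u ∈ Icc (0 : ℝ) 1 ∧ R u = b})) :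
    Icc i j ⊆ Icc (0 : ℝ) 1 := fun _ hu =>
  ⟨(trim_i_spec hR hi).1.1.trans hu.1, hu.2.trans (trim_j_spec hR hj).1.2⟩

end Summit.CriticalPhenomena.SAWScalingLimit.Theorems
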